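import Literature.AnabelianGeometry.EtaleTheta.FrobenioidMonoTheta
import Literature.AnabelianGeometry.EtaleTheta.CyclotomicEnvelope
import Mathlib.GroupTheory.Subgroup.Centralizer
import Mathlib.GroupTheory.QuotientGroup.Basic

/-!
# [EtTh] Lemma 5.9 (iii): the outer action `ℓ·ℤ ⥲ Π^tp_X/Π^tp_Y → Out(E_N)` as a LITERAL homomorphism (p. 332 / PDF p. 106)

S. Mochizuki, *The étale theta function and its Frobenioid-theoretic manifestations*, Publ. RIMS **45**
(2009) [cite: MochizukiEtTh2009, Lem 5.9 (iii) p.332 (PDF p.106)]: "We have a natural outer action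
`l·ℤ ⥲ Π^tp_X/Π^tp_Y → Out(E_N)` determined by conjugating via the composite of the natural outer
homomorphism `Π^tp_X ↠ Aut_D(B_N^bs)` with `s^⊓-gp_N : Aut_D(B_N^bs) → Aut_C(B_N)`."

abc-iut cell, seat abc-iut-w6-d078 (block C / W6).  PROOF-ONLY companion (no definitions) of
abc-iut-L2-t4's `FrobenioidMonoTheta.lean`, where Lemma 5.9 (iii) is typed as its CONTENT —
`ThetaFrobenioid.OuterActionLZ` (every element of `Π^tp_X̲` normalises `E_N` through `s^⊓-gp_N ∘ ρ`, PROVED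
unconditionally: `outerActionLZ_of`) and `sgpCap_rho_mem_EN` (`Π^tp_Y̲` acts by inner automorphisms).  Here the
printed object itself is produced, over abc-iut-L2-t2's `Out G := Aut(G)/Inn(G)` (`CyclotomicEnvelope.lean`):
* `sgpCap_rho_mem_normalizer_EN` — `s^⊓-gp_N(ρ g)` normalises `E_N` (pointwise form of `outerActionLZ_of`);
* `exists_outerHom_EN` — there is a UNIQUE homomorphism `Π^tp_X̲/Π^tp_Y̲ →* Out(E_N)` whose value at the
  class of `g` is the class of conjugation by `s^⊓-gp_N(ρ g)` (well-defined because `Π^tp_Y̲` acts innerly);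
* `exists_outerHom_EN_int` — the same through the structure isomorphism `Π^tp_X̲/Π^tp_Y̲ ⥲ ℤ`
  (`zquot`, surjective with kernel `Π^tp_Y̲`; print's label "`l·ℤ`" is notational): a UNIQUE homomorphism
  `ℤ →* Out(E_N)` with the same values.
No new hypothesis; everything is over the §5 data record `ThetaFrobenioid`.  HONEST FRAMING: refereed pre-IUT
material; nothing here bears on [IUTchIII] Cor. 3.12 and no side is taken; typed ≠ proved except for the
theorems of this file.
-/

namespace Literature.AnabelianGeometry.EtaleTheta

open CategoryTheory

universe w v v' u u'

namespace ThetaFrobenioid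

variable {C : Type u} [Category.{v} C] {D : Type u'} [Category.{v'} D] (𝔉 : ThetaFrobenioid.{w} C D)

/-- Pointwise form of Lemma 5.9 (iii)'s normalisation (`outerActionLZ_of`): for every `g ∈ Π^tp_X̲`,
`s^⊓-gp_N(ρ g)` normalises `E_N`. [cite: MochizukiEtTh2009, Lem 5.9 (iii) p.332 (PDF p.106)] -/
theorem sgpCap_rho_mem_normalizer_EN (g : 𝔉.PiX) :
    𝔉.sgpCap (𝔉.ρ g) ∈ Subgroup.normalizer (𝔉.EN : Set (Aut 𝔉.BN)) :=
  𝔉.outerActionLZ_of ⟨g, Subgroup.mem_top g, rfl⟩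

/-- For `y ∈ Π^tp_Y̲` the automorphism of `E_N` given by conjugation by `s^⊓-gp_N(ρ y)` is INNER (the
conjugating element lies in `E_N`, `sgpCap_rho_mem_EN`), i.e. trivial in `Out(E_N)`.
[cite: MochizukiEtTh2009, Lem 5.9 (iii) p.332 (PDF p.106)] -/
theorem normalizerMonoidHom_sgpCap_rho_mem_innerAut {y : 𝔉.PiX} (hy : y ∈ 𝔉.PiY) :
    𝔉.EN.normalizerMonoidHom ⟨𝔉.sgpCap (𝔉.ρ y), 𝔉.sgpCap_rho_mem_normalizer_EN y⟩ ∈ innerAut 𝔉.EN := by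
  refine ⟨⟨𝔉.sgpCap (𝔉.ρ y), 𝔉.sgpCap_rho_mem_EN hy⟩, ?_⟩
  ext e
  simp [MulAut.conj_apply]

/-- **[EtTh] Lemma 5.9 (iii), literal form on `Π^tp_X̲/Π^tp_Y̲`** (`Π^tp_Y̲ = Ker(zquot)` by definition,
`ThetaFrobenioid.PiY`): there is a unique homomorphism `Φ : Π^tp_X̲/Π^tp_Y̲ →* Out(E_N)` sending the class of
`g` to the class of conjugation by `s^⊓-gp_N(ρ g)` ("determined by conjugating via the composite of
`Π^tp_X ↠ Aut_D(B_N^bs)` with `s^⊓-gp_N`").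
[cite: MochizukiEtTh2009, Lem 5.9 (iii) p.332 (PDF p.106)] -/
theorem exists_outerHom_EN :
    ∃! Φ : 𝔉.PiX ⧸ 𝔉.zquot.ker →* Out 𝔉.EN, ∀ g : 𝔉.PiX,
      Φ (QuotientGroup.mk g) =
        QuotientGroup.mk (𝔉.EN.normalizerMonoidHom ⟨𝔉.sgpCap (𝔉.ρ g), 𝔉.sgpCap_rho_mem_normalizer_EN g⟩) := by
  -- the conjugation action `Π^tp_X̲ → Aut(E_N)` through `s^⊓-gp_N ∘ ρ`
  let ψ : 𝔉.PiX →* MulAut 𝔉.EN :=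
    𝔉.EN.normalizerMonoidHom.comp
      ((𝔉.sgpCap.comp 𝔉.ρ).codRestrict (Subgroup.normalizer (𝔉.EN : Set (Aut 𝔉.BN)))
        fun g => 𝔉.sgpCap_rho_mem_normalizer_EN g)
  let θ : 𝔉.PiX →* Out 𝔉.EN := (QuotientGroup.mk' (innerAut 𝔉.EN)).comp ψ
  have hθ : ∀ g : 𝔉.PiX, θ g =
      QuotientGroup.mk (𝔉.EN.normalizerMonoidHom ⟨𝔉.sgpCap (𝔉.ρ g), 𝔉.sgpCap_rho_mem_normalizer_EN g⟩) :=
    fun _ => rfl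
  have hker : 𝔉.zquot.ker ≤ θ.ker := by
    intro y hy
    rw [MonoidHom.mem_ker, hθ, QuotientGroup.eq_one_iff]
    exact 𝔉.normalizerMonoidHom_sgpCap_rho_mem_innerAut hy
  refine ⟨QuotientGroup.lift 𝔉.zquot.ker θ hker, fun g => by rw [QuotientGroup.lift_mk, hθ], ?_⟩
  intro Φ hΦ
  ext g
  change Φ (QuotientGroup.mk g) = QuotientGroup.lift _ θ hker (QuotientGroup.mk g)
  rw [QuotientGroup.lift_mk, hθ]
  exact hΦ g

/-- The structure isomorphism `Π^tp_X̲/Π^tp_Y̲ ⥲ ℤ` (`zquot` is surjective with kernel `Π^tp_Y̲`; print's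
"`l·ℤ`", the label being notational) sends the class of `g` to `zquot g`.
[cite: MochizukiEtTh2009, §5 p.331 (PDF p.105)] -/
theorem quotientKerEquiv_zquot_mk (g : 𝔉.PiX) :
    QuotientGroup.quotientKerEquivOfSurjective 𝔉.zquot 𝔉.zquot_surjective (QuotientGroup.mk g) = 𝔉.zquot g :=
  rfl

/-- **[EtTh] Lemma 5.9 (iii), literal form on `ℤ ≅ Π^tp_X̲/Π^tp_Y̲`**: there is a unique homomorphism
`Φ : ℤ →* Out(E_N)` with `Φ(zquot g) = [conjugation by s^⊓-gp_N(ρ g)]` for every `g ∈ Π^tp_X̲` — the printed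
"natural outer action `l·ℤ ⥲ Π^tp_X/Π^tp_Y → Out(E_N)`" as a term.
[cite: MochizukiEtTh2009, Lem 5.9 (iii) p.332 (PDF p.106)] -/
theorem exists_outerHom_EN_int :
    ∃! Φ : Multiplicative ℤ →* Out 𝔉.EN, ∀ g : 𝔉.PiX,
      Φ (𝔉.zquot g) =
        QuotientGroup.mk (𝔉.EN.normalizerMonoidHom ⟨𝔉.sgpCap (𝔉.ρ g), 𝔉.sgpCap_rho_mem_normalizer_EN g⟩) := by
  obtain ⟨Φ, hΦ, -⟩ := 𝔉.exists_outerHom_EN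
  let e : 𝔉.PiX ⧸ 𝔉.zquot.ker ≃* Multiplicative ℤ :=
    QuotientGroup.quotientKerEquivOfSurjective 𝔉.zquot 𝔉.zquot_surjective
  have he : ∀ g : 𝔉.PiX, e.symm (𝔉.zquot g) = (QuotientGroup.mk g : 𝔉.PiX ⧸ 𝔉.zquot.ker) := by
    intro g
    apply e.injective
    rw [MulEquiv.apply_symm_apply]
    rfl
  refine ⟨Φ.comp e.symm.toMonoidHom, fun g => ?_, ?_⟩
  · change Φ (e.symm (𝔉.zquot g)) = _
    rw [he, hΦ]
  · intro Ψ hΨ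
    refine MonoidHom.ext fun n => ?_
    obtain ⟨g, rfl⟩ := 𝔉.zquot_surjective n
    change Ψ (𝔉.zquot g) = Φ (e.symm (𝔉.zquot g))
    rw [he, hΦ, hΨ]

end ThetaFrobenioid

end Literature.AnabelianGeometry.EtaleTheta
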